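import Literature.Computability.QuantumComplexity.GenKit
import Literature.Computability.QuantumComplexity.QFTKit
import Literature.Computability.QuantumComplexity.CoreDescAbstract
import HarnessLib

/-!
# Abstract (ℕ-valued) parameters of the generic gadget kits `GenKit.kit` and `QFTKit.kit`

Topic `Literature/Computability/QuantumComplexity`; a companion of `GenKit.lean` / `QFTKit.lean` for UNIFORMITY
proofs in the abstract-gate-list style of `CoreDescAbstract.lean`. There, the record `AJLCore.BP` abstracts the AJL
block kit `BlockKit.kit n r k`; its dummy offset `BlockKit.dataOff n r` is specific to that block, so `BP` cannot be
instantiated for the kits of Regev's sampler (the Grover–Rudolph blocks use `GRData.kit = GenKit.kit ps dsz k`, the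
Fourier blocks `QFTKit.kit κ k`). This file is the same abstraction with the dummy offset a FIELD:

* `GP` — `{dOff, k, R, F, T}` and, verbatim from `BP`, the derived numbers `Wd, scr, rs, rbv, b, fb, sb`, the wire
  value `w v = v % b`, the wires `cr, d0, as, hs, region`, the abstract layout `layA`, compiled flag programs `gopsA`,
  flags `gflagA`, and the kit reflection `GRA`;
* `GenKit.gpOf ps dsz k`, **`GenKit.kit_as_val/kit_hs_val/kit_region_val/useLayout_eq/map_val_gadgetOps/val_gadgetFlag`**;
* `QFTKit.gpOf κ k` and the same six lemmas for `QFTKit.kit κ k`.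

With these, the flag programs `GRWord.grOps` / `QFTWord.phaseOps` of the sampler's blocks (both `gadgetOps` of a
`useLayout`) abstract to `gp.gopsA insA c` exactly as AJL's (`CoreDescAbstract.map_toAG_rotWord`); computing
`GP.gopsA` on codes is then the verbatim analogue of `CoreDescBlockFP` §BP. Everything is proved; no named fact.

## References

* S. Arora, B. Barak, *Computational Complexity: A Modern Approach*, CUP 2009, §6.2 and proof of Thm. 6.15
  [AroraBarak2009].
* O. Regev, J. ACM 56(6) (2009), Lemma 3.14 (proof: uniformity of the sampler) [Regev2009].
* D. Aharonov, V. Jones, Z. Landau, Algorithmica 55 (2009), Claim 4.1 (the gadget word shape) [AharonovJonesLandau2009].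
-/

noncomputable section

namespace Literature.Computability.QuantumComplexity

open _root_.Computability Cryptography RevSim AJLCore GadgetKit

/-! ### Generic kit parameters -/

/-- **Generic kit parameters**: dummy offset `dOff` (= the number of data wires before the kit), averaging bits `k`,
and the register / flag / scratch counts `R, F, T` of the classical region. [folklore] -/
structure GP where
  /-- offset of the dummy wire -/
  dOff : ℕ
  /-- averaging bits -/
  k : ℕ
  /-- registers -/
  R : ℕ
  /-- flags -/
  F : ℕ
  /-- scratch blocks -/
  T : ℕ

namespace GP

variable (p : GP)

/-- Classical word width `4k + 16`. [folklore] -/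
def Wd : ℕ := SLP.thrWd p.k
/-- Scratch block size. [folklore] -/
def scr : ℕ := SLP.scrSize p.Wd
/-- Region size `R·Wd + F + T·scr`. [folklore] -/
def rs : ℕ := p.R * p.Wd + p.F + p.T * p.scr
/-- Base of the register block. [folklore] -/
def rbv : ℕ := p.dOff + 2 + p.k + (p.k + p.rs)
/-- Block size. [folklore] -/
def b : ℕ := p.rbv + p.rs
/-- Base of the flag block. [folklore] -/
def fb : ℕ := p.rbv + p.R * p.Wd
/-- Base of the scratch blocks. [folklore] -/
def sb : ℕ := p.fb + p.F
/-- Wire number `v` (the value of `RevSim.finOf b _ v`). [folklore] -/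
def w (v : ℕ) : ℕ := v % p.b
/-- The Hadamard column / selector wire. [folklore] -/
def cr : ℕ := p.w (p.dOff + 1)
/-- The dummy wire. [folklore] -/
def d0 : ℕ := p.w p.dOff
/-- The averaging wires. [folklore] -/
def as : List ℕ := (List.range p.k).map fun j => p.w (p.dOff + 2 + j)
/-- The reflection helpers. [folklore] -/
def hs : List ℕ := (List.range (p.k + p.rs)).map fun j => p.w (p.dOff + 2 + p.k + j)
/-- The classical region. [folklore] -/
def region : List ℕ :=
  ((List.range (p.R * p.Wd)).map (fun i => p.rbv + i) ++ (List.range p.F).map (fun i => p.fb + i) ++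
    (List.range (p.T * p.scr)).map (fun i => p.sb + i)).map p.w

/-- **The abstract layout** of a gadget reading `as`, `cr`, then the wires `ins`. [folklore] -/
def layA (ins : List ℕ) : SLP.Layout where
  kIn := p.k + 1 + ins.length
  rb := p.rbv
  fb := p.fb
  sb := p.sb
  iw j := if j < p.k then p.w (p.dOff + 2 + j) else if j = p.k then p.cr else ins.getD (j - (p.k + 1)) p.cr

/-- The abstract compiled flag program of a gadget, from the compiler output `c`. [folklore] -/
def gopsA (ins : List ℕ) (c : List SLP.Instr × ℕ × ℕ × ℕ) : List (ClOp ℕ) := (SLP.compile (p.layA ins) (Wd := p.Wd) c.1).map (ClOp.map p.w)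

/-- The abstract flag wire of the result flag of a compiler output. [folklore] -/
def gflagA (c : List SLP.Instr × ℕ × ℕ × ℕ) : ℕ := p.w (p.fb + c.2.1)

/-- The abstract reflection of the kit. [folklore] -/
def GRA : List AG := reflectA p.cr (p.as ++ p.region) p.hs

end GP

/-! ### `GenKit.kit` is abstract -/

namespace GenKit

variable (ps : List SLP.BExpr) (dsz k : ℕ)

/-- The parameters of the generic kit. [folklore] -/
def gpOf : GP := ⟨dsz, k, gR ps k, gF ps k, gT ps k⟩

/-- The block size agrees. [folklore] -/
theorem gpOf_b : (gpOf ps dsz k).b = bsize ps dsz k := rfl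

/-- Values of block wires. [folklore] -/
theorem wire_val_eq (v : ℕ) : (wire ps dsz k v : ℕ) = (gpOf ps dsz k).w v := rfl

/-- The averaging wires. [folklore] -/
theorem kit_as_val : (kit ps dsz k).as.map Fin.val = (gpOf ps dsz k).as := by
  rw [kit_as, List.map_map]; rfl

/-- The selector wire. [folklore] -/
theorem kit_cr_val : ((kit ps dsz k).cr : ℕ) = (gpOf ps dsz k).cr := rfl

/-- The dummy wire. [folklore] -/
theorem kit_d0_val : ((kit ps dsz k).d0 : ℕ) = (gpOf ps dsz k).d0 := rfl

/-- The helpers. [folklore] -/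
theorem kit_hs_val : (kit ps dsz k).hs.map Fin.val = (gpOf ps dsz k).hs := by
  rw [kit_hs, List.map_map]; rfl

/-- The region. [folklore] -/
theorem kit_region_val : (kit ps dsz k).region.map Fin.val = (gpOf ps dsz k).region := by
  rw [GadgetKit.region, layoutRegion, List.map_map, GP.region]; rfl

/-- **The layout of the kit is the abstract layout.** [folklore] -/
theorem useLayout_eq (ins : List (Fin (bsize ps dsz k))) : (kit ps dsz k).useLayout ins = (gpOf ps dsz k).layA (ins.map Fin.val) := by
  have hlen : (kit ps dsz k).as.length = k := by rw [kit_as, List.length_map, List.length_range]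
  simp only [GadgetKit.useLayout, GP.layA, List.length_map]
  congr 1
  funext j
  by_cases hj : j < k
  · rw [dif_pos (by rw [hlen]; exact hj), if_pos (show j < (gpOf ps dsz k).k from hj)]
    simp only [kit_as, List.getElem_map, List.getElem_range]; rfl
  · rw [dif_neg (by rw [hlen]; exact hj), if_neg (show ¬ j < (gpOf ps dsz k).k from hj)]
    by_cases hjk : j = k
    · rw [if_pos (show j = (kit ps dsz k).k from hjk), if_pos (show j = (gpOf ps dsz k).k from hjk)]; rfl
    · rw [if_neg (show ¬ j = (kit ps dsz k).k from hjk), if_neg (show ¬ j = (gpOf ps dsz k).k from hjk),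
        show (gpOf ps dsz k).cr = Fin.val (kit ps dsz k).cr from rfl, List.getD_map]; rfl

/-- **Abstraction of a gadget's flag program.** [cite: AroraBarak2009, §6.2] -/
theorem map_val_gadgetOps (ins : List (Fin (bsize ps dsz k))) (b : SLP.BExpr) :
    (gadgetOps (bsize_pos ps dsz k) ((kit ps dsz k).useLayout ins) b (Wd := SLP.thrWd k)).map (ClOp.map Fin.val) =
      (gpOf ps dsz k).gopsA (ins.map Fin.val) (b.compile (SLP.thrWd k) 0 0) := by
  rw [gadgetOps, map_val_map_finOf, useLayout_eq]; rfl

/-- Abstraction of a gadget's flag wire. [folklore] -/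
theorem val_gadgetFlag (ins : List (Fin (bsize ps dsz k))) (b : SLP.BExpr) :
    (gadgetFlag (bsize_pos ps dsz k) ((kit ps dsz k).useLayout ins) b (Wd := SLP.thrWd k) : ℕ) =
      (gpOf ps dsz k).gflagA (b.compile (SLP.thrWd k) 0 0) := rfl

/-- Abstraction of the kit's reflection. [folklore] -/
theorem map_toAG_reflect_kit (hne : (kit ps dsz k).hs ≠ [])
    (hwf : ∀ op ∈ reflectProg (kit ps dsz k).cr ((kit ps dsz k).as ++ (kit ps dsz k).region) (kit ps dsz k).hs, op.WF) :
    (reflectCircuit (kit ps dsz k).cr ((kit ps dsz k).as ++ (kit ps dsz k).region) (kit ps dsz k).hs hne hwf).gates.map toAG =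
      (gpOf ps dsz k).GRA := by
  rw [map_toAG_reflectCircuit, List.map_append, kit_as_val, kit_region_val, kit_hs_val]; rfl

end GenKit

/-! ### `QFTKit.kit` is abstract -/

namespace QFTKit

variable (κ k : ℕ)

/-- The parameters of the Fourier kit. [folklore] -/
def gpOf : GP := ⟨κ, k, qR k κ, qF k κ, qT k κ⟩

/-- The block size agrees. [folklore] -/
theorem gpOf_b : (gpOf κ k).b = qbsize κ k := rfl

/-- Values of block wires. [folklore] -/
theorem wire_val_eq (v : ℕ) : (wire κ k v : ℕ) = (gpOf κ k).w v := rfl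

/-- The averaging wires. [folklore] -/
theorem kit_as_val : (kit κ k).as.map Fin.val = (gpOf κ k).as := by
  rw [kit_as, List.map_map]; rfl

/-- The selector wire. [folklore] -/
theorem kit_cr_val : ((kit κ k).cr : ℕ) = (gpOf κ k).cr := rfl

/-- The dummy wire. [folklore] -/
theorem kit_d0_val : ((kit κ k).d0 : ℕ) = (gpOf κ k).d0 := rfl

/-- The helpers. [folklore] -/
theorem kit_hs_val : (kit κ k).hs.map Fin.val = (gpOf κ k).hs := by
  rw [kit_hs, List.map_map]; rfl

/-- The region. [folklore] -/
theorem kit_region_val : (kit κ k).region.map Fin.val = (gpOf κ k).region := by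
  rw [GadgetKit.region, layoutRegion, List.map_map, GP.region]; rfl

/-- **The layout of the kit is the abstract layout.** [folklore] -/
theorem useLayout_eq (ins : List (Fin (qbsize κ k))) : (kit κ k).useLayout ins = (gpOf κ k).layA (ins.map Fin.val) := by
  have hlen : (kit κ k).as.length = k := by rw [kit_as, List.length_map, List.length_range]
  simp only [GadgetKit.useLayout, GP.layA, List.length_map]
  congr 1
  funext j
  by_cases hj : j < k
  · rw [dif_pos (by rw [hlen]; exact hj), if_pos (show j < (gpOf κ k).k from hj)]
    simp only [kit_as, List.getElem_map, List.getElem_range]; rfl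
  · rw [dif_neg (by rw [hlen]; exact hj), if_neg (show ¬ j < (gpOf κ k).k from hj)]
    by_cases hjk : j = k
    · rw [if_pos (show j = (kit κ k).k from hjk), if_pos (show j = (gpOf κ k).k from hjk)]; rfl
    · rw [if_neg (show ¬ j = (kit κ k).k from hjk), if_neg (show ¬ j = (gpOf κ k).k from hjk),
        show (gpOf κ k).cr = Fin.val (kit κ k).cr from rfl, List.getD_map]; rfl

/-- **Abstraction of a gadget's flag program.** [cite: AroraBarak2009, §6.2] -/
theorem map_val_gadgetOps (ins : List (Fin (qbsize κ k))) (b : SLP.BExpr) :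
    (gadgetOps (qbsize_pos κ k) ((kit κ k).useLayout ins) b (Wd := SLP.thrWd k)).map (ClOp.map Fin.val) =
      (gpOf κ k).gopsA (ins.map Fin.val) (b.compile (SLP.thrWd k) 0 0) := by
  rw [gadgetOps, map_val_map_finOf, useLayout_eq]; rfl

/-- Abstraction of a gadget's flag wire. [folklore] -/
theorem val_gadgetFlag (ins : List (Fin (qbsize κ k))) (b : SLP.BExpr) :
    (gadgetFlag (qbsize_pos κ k) ((kit κ k).useLayout ins) b (Wd := SLP.thrWd k) : ℕ) = (gpOf κ k).gflagA (b.compile (SLP.thrWd k) 0 0) := rfl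

/-- Abstraction of the kit's reflection. [folklore] -/
theorem map_toAG_reflect_kit (hne : (kit κ k).hs ≠ [])
    (hwf : ∀ op ∈ reflectProg (kit κ k).cr ((kit κ k).as ++ (kit κ k).region) (kit κ k).hs, op.WF) :
    (reflectCircuit (kit κ k).cr ((kit κ k).as ++ (kit κ k).region) (kit κ k).hs hne hwf).gates.map toAG = (gpOf κ k).GRA := by
  rw [map_toAG_reflectCircuit, List.map_append, kit_as_val, kit_region_val, kit_hs_val]; rfl

end QFTKit

end Literature.Computability.QuantumComplexity

end
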